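import Literature.NumberTheory.EllipticCurves.YanZhu2026.AnticyclotomicMainTheorems
import HarnessLib

/-!
# Yan–Zhu 2026 (J. Algebra 693 = arXiv:2412.20078v4), §5.2: Theorem 5.9 (= arXiv v2 Thm. 4.14) —
# `𝒳_{𝓕_Gr}(E/K_∞⁻)` is `Λ_K⁻`-torsion, and for EVERY nontrivial multiplicative `S ⊂ Λ_K⁻` the
# `S`-localised BDP divisibility is EQUIVALENT to the `S`-localised Heegner point divisibility (both
# directions), at an odd good ordinary split prime under the Heegner hypothesis and irreducibility of
# `ρ̄_E|_{G_K}` ("Arguing as in [BCK, Theorem 5.2]")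

Source: Xiaojun Yan, Xiuwu Zhu, *Main conjectures for non-CM elliptic curves at good ordinary primes*,
J. Algebra **693** (2026) 372–402, doi:10.1016/j.jalgebra.2026.01.016 = arXiv:2412.20078. Locators:
arXiv **v4** TeX `main.tex` (journal numbering; held at `run/shared/lean/b2b/bsd-rank1-residual/
b2b-bsdres-lit/g98/eprints/yz_v4/`): §5.2 setting l.1189–1190, statement 5.5 l.1192–1197,
`S_ord(E/K_∞⁻)` l.1199–1203, Perrin-Riou's `κ` l.1205–1207, statement 5.6 l.1209–1215, **Theorem 5.9**
(`\label{ant}`) l.1283–1293, its use in the proof of Thm. 5.7 l.1295–1308; = arXiv v2 Thm. 4.14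
[corpus:paper:arxiv-2412.20078 p0011–p0012]. Bib key `YanZhu2024MainConjNonCM`. Cell `pub/bsd-littype`
(typing layer D-0088(4)), seat `bsd-littype-04` (gen 2), closing the typed gap "G4" of
`staging/bsd-littype-04/SHEETS-04.md` ("Thm 5.9 / BCK Thm 5.2 S⁻¹-equivalences: absent at general S").
The companion file `AnticyclotomicMainTheorems.lean` (Thm. 5.7 (1)/(2)) fixes the vocabulary; this
file adds ONE named fact in exactly that currency and restates nothing.

## The printed statement (v4 l.1283–1293, verbatim) and its setting

Setting (§5.2, l.1189–1190): "Let `E/ℚ` be an elliptic curve of conductor `N`, let `p > 2` be a prime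
such that `E` has good ordinary reduction at `p`, and let `K` be an imaginary quadratic field such that
`p𝒪_K = 𝔭𝔭̄` splits in `K` and the pair `(E, K)` satisfies the Heegner hypothesis. Assume that the
residual representation `ρ̄_E|_{G_K} : G_K → Aut(E[p])` is irreducible." (`𝓛_p^BDP(E/K) := 𝓛_p^BDP(f/K)`,
Thm. 3.13, under §3.5's standing "`D_K` is odd and not equal to `−3`", l.882; "Fix a modular
parametrization `π : X₀(N) → E` … `κ ∈ S_ord(E/K_∞⁻)` using the Kummer images of Heegner points on
`X₀(N)`", l.1205–1207.)

"Arguing as in [BCK, Theorem 5.2], we obtain the following result. **Theorem 5.9.** The module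
`𝒳_{𝓕_Gr}(E/K_∞⁻)` is `Λ_K⁻`-torsion, and for every nontrivial multiplicative set `S ⊂ Λ_K⁻`, the
following statements are equivalent: (1) `S⁻¹Char_{Λ_K⁻}(𝒳_{𝓕_Gr}(E/K_∞⁻))Λ_K^{ur,−} ⊃ (𝓛_p^BDP(E/K))`.
(2) `S⁻¹Char_{Λ_K⁻}(𝒳_{𝓕_ord}(E/K_∞⁻)_tor) ⊃ S⁻¹Char_{Λ_K⁻}(S_ord(E/K_∞⁻)/Λ_K⁻·κ)²`. The equivalence
also holds with the divisibility reversed." ([BCK] = Burungale–Castella–Kim, Algebra Number Theory 15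
(2021), Thm. 5.2, printed for `p > 3`; the theorem here is Yan–Zhu's, at every `p > 2`.)

## Transcription (the currency of `thm57_isTorsion_charIdealXGr_eq_bdpLFunction` and
`thm57_rankOne_charIdealTorsion_eq_heegnerCharIdeal_sq`, binder for binder)

* hypotheses: `Thm57Hypotheses N W K p κ γ` (the printed setting + §3.5's `D_K` odd, `≠ −3` + the
  tree Heegner-family vocabulary's EXTRA `p ∤ h_K`, special case, as in the companion), the embedding
  datum `ι' : ℚ̄_p ≃ ℂ` singling out `𝔭 = v` (compatibility clause verbatim), `𝔭̄ = vbar ∋ p`,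
  `vbar ≠ v`, `f` the newform of `W` (`IsNewformOf W f`), `[Fact (κ.IsTopGenerator γ)]`;
* `𝒳_{𝓕_Gr}(E/K_∞⁻) = AcSelmer.XAc (W.baseChange K) p κ vbar ∅ γ` (strict at `v̄`, relaxed at `v`), its
  characteristic ideal `AcSelmer.XAc.charIdeal …`, extended to `Λ_K^{ur,−} = R₀⟦T⟧` along THE structure
  map `j : ℤ_p → R₀` (universally quantified with its characterisation `j(x) = x` in `ℂ_p`);
* `𝓛_p^BDP(E/K)`: a frame `(Ω_K ≠ 0, Ω_p ∈ R₀ˣ, L)` with `IsBDPLFunction ι' v κ γ f Ω_K Ω_p L`;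
* `S_ord(E/K_∞⁻) = D.S` (`D : LambdaAdicSelmerData`), `Λ_K⁻·κ = heegnerModule D F` for a Heegner family
  `F : HeegnerFamily N W K κ jbar` at level `N = N_E`, so `Char(S_ord/Λκ)² = (heegnerCharIdeal D F)²`;
  `𝒳_{𝓕_ord}(E/K_∞⁻)_tor = Submodule.torsion Λ X.X` (`X : SelmerDualData κ γ`);
* "for every nontrivial multiplicative `S ⊂ Λ_K⁻`, (1) ⟺ (2)" in the equivalent ONE-ELEMENT form: for
  every `s ∈ Λ = ℤ_p⟦T⟧`, `s ≠ 0`, with `S = {sⁿ}` — (1)_s: `sⁿ · L ∈ Char(𝒳_Gr)·R₀⟦T⟧` for some `n`;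
  (2)_s: `sⁿ · (heegnerCharIdeal)² ⊆ Char(𝒳_tor)` for some `n`; reversed: (1')_s: `sⁿ · Char(𝒳_Gr)R₀⟦T⟧ ⊆
  (L)`, (2')_s: `sⁿ · Char(𝒳_tor) ⊆ (heegnerCharIdeal)²`. (Each printed side is "∃ t ∈ S, φ(t)" with
  `φ` monotone along divisibility, the ideals being finitely generated over the Noetherian `Λ`; hence
  "∀ S, P(S) ↔ Q(S)" ⟺ "∀ s ≠ 0, P({sⁿ}) ↔ Q({sⁿ})": given `S ∋ t` with `φ_P(t)`, apply the
  one-element case to `t`.)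

Status: REFEREED and published; the printed proof is by reference to [BCK, Thm. 5.2] (published, ANT
15); no Beilinson–Flach input (flag-free). Nothing is asserted (D-0014): one named fact, no `_holds`.

## The normalisation of `κ` in print, and the PINNED typing (2026-08-28, cell `pub/bsd-print-x9`,
## planner finding PIN-1; literature seat `bsd-print-x9-lit` g25, texts READ at the line)

Print's equivalence is a statement about ONE Heegner class `κ`, built with ONE fixed parametrisation,
and its transfer to the BDP side is EXACT only for the normalisation in which the Manin constant of
that parametrisation is a `p`-adic unit:

* [BCK21] (the source of the proof "Arguing as in [BCK, Theorem 5.2]"), Remark 1.2 (after Conj. 1.1)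
  (arXiv:1908.09512v2 = journal text, TeX l.192–195, verbatim): "As formulated in [PR87, Conj. B], the
  second equality of characteristic ideals in (ii) includes the factor `c_π · (#𝒪_K^×)/2`, where
  `c_π ∈ ℤ_{>0}` is the Manin constant associated to `π`. However, `𝒪_K^× = {±1}` by our hypothesis
  (disc), and `c_π` is a `p`-adic unit by [Mazur 1978] and our hypothesis that `p ∤ N`." Its classes
  `κ_∞` are the Kummer images of CM points of the JACOBIAN `J(X_{N⁺,N⁻})` in `𝐓` (§3, TeX l.655–672,
  `ι_m`, `α_p^{-n}`-normalised traces), for which the explicit reciprocity law is EXACT: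
  "`Log_𝔭(loc_𝔭(κ_∞)) = −𝓛_𝔭^BDP · σ_{−1,𝔭}`" (Thm. 4.4 of the journal = TeX l.929–941, eq. (ERL)),
  whence the EXACT identity "`ord_{𝔓'}(𝓛_𝔭^BDP) = length_{𝔓'}(coker(loc_𝔭)Λ^ur) +
  length_{𝔓'}(𝒮^ur/Λ^ur κ_∞)`" (eq. (A4) in the proof of Thm. 5.2, TeX l.1079–1081) on which the
  equivalence rests; in elliptic-curve currency (App. A, TeX l.1116–1120): "After possibly changing `E`
  within its isogeny class, we shall assume that `E` is `(ℤ, pℤ_p)`-optimal in the sense of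
  [W. Zhang 2014, §3.7] … Letting `π : J(X_{N⁺,N⁻}) → E` be the quotient map, `z₁ := π(ι₁(x₁))`."
* [CGLS22] Castella–Grossi–Lee–Skinner, Invent. Math. 227 (2022), §1, Conj. 1 (arXiv:2008.02571
  p. 3, verbatim): "let `c_E ∈ ℤ` be such that `π^*(ω_E) = c_E · 2πi f(τ)dτ`, for `ω_E` a Néron
  differential on `E` … `char_Λ(X_tors) = (1/(c_E² u_K²)) · char_Λ(𝒮/Λκ₁^Hg)²`, where
  `u_K = #(𝒪_K^×)/2`" — the factor carried explicitly for an arbitrary fixed `π`.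
* [YZ26] itself: "Fix a modular parametrization `π : X₀(N) → E`. In [PR], Perrin-Riou constructed an
  element `κ ∈ S_ord(E/K_∞⁻)` via the Kummer images of Heegner points on `X₀(N)`" (v2 p0011 L59) and
  "Similarly to [BCK]" (L96): silent on `c_π`; the proof-by-reference inherits [BCK21]'s normalisation
  (its Def. 3.4 shows the authors tracking `deg(π_E)/c_E²` on the cyclotomic side).

The tree's `HeegnerFamily N W K κ jbar` carries its OWN datum `F.Dt` with Manin constant `F.Dt.c`
(`φ = uniformize (c · 2πi ∫ f)`, i.e. `φ^* ω_E = c · 2πi f dτ`, `ModularCurve.lean`), and rescaled data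
`Dt.zsmul m` (`c ↦ m c`) / families `F.zsmulSelf m` (`ModularParametrizationScalingProofs.lean`,
`HeegnerFamilyScalingProofs.lean`) are CONSTRUCTED, with `I(ℋ_{m•F}) = I(ℋ_F)` for `p ∤ m`
(`heegnerCharIdeal_zsmulSelf_of_not_dvd`, `HeegnerModuleScalingProofs.lean`) and `ℋ̄_k(m • F) =
m • ℋ̄_k(F)` for every `m` (`heegnerModuleLayer_zsmul`). The first named fact below quantifies `∀ F`
WITHOUT restricting `F.Dt.c`; read at a family and at its `p`-rescaling it would turn the printed
equivalence into "`I(ℋ_F)² ⊆ char ⟺ p² I(ℋ_F)² ⊆ char`", which print does not assert (the `μ`-part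
for free). It is therefore FLAGGED `layout: unpinned family` (statement unchanged, kept for its
consumers) and SUPERSEDED for route use by the PINNED twin
`thm59_XGr_isTorsion_bdp_iff_heegnerPoint_localised_pinned`: the same statement with the hypothesis
`¬ (p : ℤ) ∣ F.Dt.c` on the family — print's "`c_π` is a `p`-adic unit" (`u_K = 1` is automatic here:
`Thm57Hypotheses.discr_odd/discr_ne` give `D_K ∉ {−3, −4}`). Under (irr) every parametrisation of `W`
is `[m] ∘ φ_min` with `p ∤ deg`-isogeny-translate `φ_min` of the optimal quotient, so `p ∤ c` singles
out exactly the prime-to-`p` multiples of print's class (same `Λκ`, same `I(ℋ)`). The pinned fact is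
implied by the unpinned one (`thm59_pinned_of_thm59`, proved): WEAKER, never stronger than the source.

## Class-number-free PINNED typing, one-way halves (2026-08-28, REF-104/106 (b)–(c) of cell
## `pub/bsd-print-x9`; literature seat `bsd-print-x9-lit` g25)

Yan–Zhu's §5.2 setting (v4 l.1189–1190 = v2 p0011 L49–L52) carries NO class-number hypothesis; the
`not_dvd_classNumber` field of `Thm57Hypotheses` is an EXTRA of the tree's Heegner-family vocabulary
(Howard 2004 §3.3, `heegnerModule D F = Λκ` at `p ∤ h_K`). PAGE CHECK of the proof-by-reference
(REF-106 (c)): [BCK21] (ANT 15 = arXiv:1908.09512v2) has no class-number hypothesis anywhere (TeX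
grep: no `h_K`, no "class number"); the class `κ_∞` of its Thm. 5.2 is `κ_∞ := lim←_j κ_j(1)` (eq.
(dist), l.700–704) built in §3 (l.655–672) from the CM points `x_m(p^n) ∈ X_m(H_{p^n})` of
Chida–Hsieh with "`K_n := H_{p^n} ∩ K_∞`" (l.662) — the largest anticyclotomic layer inside the ring
class field of conductor `p^n`, i.e. CGLS's `d(k)`-bookkeeping — and `α_p^{-n}`-normalised traces
(l.664–666): class-number-FREE. Castella–Grossi–Lee–Skinner 2022 print the same equivalence at ANY
class number explicitly: **Prop. 4.2.1** (arXiv:2008.02571 p0022 L104–p0023 L9, verbatim): "Assume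
that `p = v v̄` splits in `K` and that `E(K)[p] = 0`, and let `Λ'` denote either `Λ` or `Λ[1/p]`. Then
the following statements are equivalent: (i) Both `H¹_{𝓕_Λ}(K, 𝐓)` and `H¹_{𝓕_Λ}(K, M_E)` have
`Λ`-rank one, and the divisibility `char_Λ(H¹_{𝓕_Λ}(K, M_E)^∨_tors) ⊃ char_Λ(H¹_{𝓕_Λ}(K, 𝐓)/Λκ_∞)²`
holds in `Λ'`. (ii) Both `𝔛_E` and `𝔖_E` are `Λ`-torsion, and the divisibility `char_Λ(𝔛_E)Λ^ur ⊃
(𝓛_E)` holds in `Λ' ⊗̂ ℤ_p^ur`. Moreover, the same result holds for the opposite divisibilities.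
*Proof.* See [BCK], whose proof still applies after inverting `p`", with `κ_∞` the `d(k)`-shifted
`α`-stabilised class of Rem. 4.1.4 (§4.1 standing: `E/ℚ` of conductor `N`, `p ∤ 2N` good ordinary,
(Heeg), (disc), "fixing a modular parameterization `π : X₀(N) → E` … `P[m] := π(x_m)`", p0022 L13–17).
Hence the transfer is PRINT at every class number (no proof-level flag for `h_K`); at `p = 3` it is
Yan–Zhu's printed extension of an argument printed for `p > 3` ([BCK21] `p ∤ 6N`), as for every `p = 3`
use of this file.

DIRECTION SAFETY (REF-106 (b)). The tree's Heegner side is `heegnerCharIdeal D F = char_Λ(𝔖/ℋ_F)`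
for Howard's MODULE `ℋ_F` of a `HeegnerFamily`, print's is `char_Λ(𝔖/Λκ)` for Perrin-Riou's CLASS.
Since `Λκ_∞ ⊆ ℋ_F` (each `κ_k` is a `ℤ_p[Gal(K_k/K)]`-combination of the family's norm points;
exact for `p ∤ h_K` and for non-anomalous `p`) one has `char(𝔖/Λκ) ⊆ I(ℋ_F)`, so of the four halves
of the printed double equivalence exactly TWO are implied by print with the tree's side (2):
**(2) ⟹ (1)** (`I(ℋ_F)² ⊆_S char(𝒳_tor)` ⟹ `char(𝔖/Λκ)² ⊆_S char(𝒳_tor)` ⟹ BDP side) and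
**(1′) ⟹ (2′)** (BDP side reversed ⟹ `char(𝒳_tor) ⊆_S char(𝔖/Λκ)² ⊆ I(ℋ_F)²`); the halves (1) ⟹ (2)
and (2′) ⟹ (1′) need `I(ℋ_F) = char(𝔖/Λκ)` (Howard Thm. 3.3.7 at `p ∤ h_K`; in general the two
modules differ by a `Λ`-module killed by `ω_δ = γ^{p^δ} − 1` and by an element prime to it, hence
pseudo-null — a literature-seat sketch recorded in the cell dossier §52, NOT a tree theorem). The
class-number-free fact below therefore records ONLY the two safe halves, PINNED (`¬ (p : ℤ) ∣ F.Dt.c`),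
on the binder list of `thm57_isTorsion_charIdealXGr_eq_bdpLFunction` + `jbar` + `N = N_E` (letter for
letter the hypothesis `h59gp` of the cell's kernel theorem
`…CompositeTransferX10b.composite_of_printFacts_of_pinnedTransfer`, p607932, whose `s = 1` instance is
the proved `bdp_mem_of_heegner_le_pinned_anyClassNumber` below).

## References
* X. Yan, X. Zhu, J. Algebra 693 (2026) = arXiv:2412.20078v4, Thm. 5.9 l.1283–1293, §5.2 l.1187–1312
  (= v2 Thm. 4.14, p0011 L59, L96–L105).
* A. Burungale, F. Castella, C.-H. Kim, Algebra Number Theory 15 (2021) 1627–1653 = arXiv:1908.09512v2,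
  Thm. 5.2 and its proof (eq. (A4), l.1079–1081); Remark 1.2 (TeX l.192–195); Thm. 4.4 (eq. (ERL),
  l.929–941); §3 (l.655–672); App. A (l.1116–1120).
* F. Castella, G. Grossi, J. Lee, C. Skinner, Invent. Math. 227 (2022) = arXiv:2008.02571, §1 Conj. 1.
  Prop. 4.2.1 (p0022 L104 – p0023 L9; the class-number-free equivalence, `E(K)[p] = 0`, `Λ' ∈ {Λ, Λ[1/p]}`),
  §4.1 standing (p0022 L5–17), Rem. 4.1.4 (`κ_∞`).
* B. Perrin-Riou, Bull. Soc. Math. France 115 (1987) 399–456, Conj. B (the factor `c · u_K`, as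
  reported by [BCK21] Remark and displayed by [CGLS22] Conj. 1). B. Mazur, Invent. Math. 44 (1978),
  Cor. 4.1 (tree fact `ModularForms.mazur_not_dvd_maninConstant_of_odd`).
* The companion `YanZhu2026/AnticyclotomicMainTheorems.lean` (vocabulary, Thm. 5.7) and its references;
  `ModularCurve.lean` (`ModularParametrizationData.c`), `HeegnerModuleScalingProofs.lean`.
-/

set_option autoImplicit false

noncomputable section

open scoped Classical

open PowerSeries WeierstrassCurve NumberField IsDedekindDomain Field
  Literature.NumberTheory.EllipticCurves Literature.NumberTheory.EllipticCurves.ModularForms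
  Literature.NumberTheory.QuadraticFields Literature.NumberTheory.EllipticCurves.Rank1Residual
  Literature.NumberTheory.EllipticCurves.Castella2018

universe u

namespace Literature.NumberTheory.EllipticCurves.YanZhu2026

/-- **Yan–Zhu, J. Algebra 693 (2026), Theorem 5.9 (arXiv v4 l.1283–1293; = v2 Thm. 4.14) — torsion of
`𝒳_{𝓕_Gr}(E/K_∞⁻)` and, for every nontrivial multiplicative `S ⊂ Λ_K⁻`, the EQUIVALENCE of the
`S`-localised BDP divisibility with the `S`-localised Heegner point divisibility, in both directions**
("Arguing as in [BCK, Theorem 5.2]"). Verbatim: "The module `𝒳_{𝓕_Gr}(E/K_∞⁻)` is `Λ_K⁻`-torsion, and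
for every nontrivial multiplicative set `S ⊂ Λ_K⁻`, the following statements are equivalent: (1)
`S⁻¹Char_{Λ_K⁻}(𝒳_{𝓕_Gr}(E/K_∞⁻))Λ_K^{ur,−} ⊃ (𝓛_p^BDP(E/K))`. (2)
`S⁻¹Char_{Λ_K⁻}(𝒳_{𝓕_ord}(E/K_∞⁻)_tor) ⊃ S⁻¹Char_{Λ_K⁻}(S_ord(E/K_∞⁻)/Λ_K⁻·κ)²`. The equivalence also
holds with the divisibility reversed", under §5.2's setting (`p > 2` good ordinary, `K` imaginary
quadratic, `p = 𝔭𝔭̄` split, `(E, K)` Heegner, `ρ̄_E|_{G_K}` irreducible) and §3.5 (`D_K` odd, `≠ −3`).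
Transcription (module docstring): hypotheses `Thm57Hypotheses N W K p κ γ` (+ EXTRA `p ∤ h_K` of the
Heegner-family vocabulary, special case), `ι'`/`v`/`vbar` embedding data, `IsNewformOf W f`; conclusion:
a frame `(Ω_K, Ω_p, L)` of `𝓛_p^BDP(E/K)` (`IsBDPLFunction`) such that `𝒳 = AcSelmer.XAc (W.baseChange K)
p κ vbar ∅ γ` is `Λ`-torsion and, for all data `D`, `F`, `X` (`S_ord = D.S`, `Λκ = heegnerModule D F`,
`𝒳_ord = X.X`) and THE structure map `j : ℤ_p → R₀`, for every `s ∈ Λ ∖ {0}` (`S = {sⁿ}`):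
[`∃ n, j(s)ⁿ·L ∈ char(𝒳)·R₀⟦T⟧`] ↔ [`∃ n, sⁿ·(heegnerCharIdeal D F)² ⊆ char(X.X_tors)`], and
[`∃ n, j(s)ⁿ·char(𝒳)·R₀⟦T⟧ ⊆ (L)`] ↔ [`∃ n, sⁿ·char(X.X_tors) ⊆ (heegnerCharIdeal D F)²`].
LAYOUT FLAG `layout: unpinned family` (2026-08-28, cell `pub/bsd-print-x9` finding PIN-1; statement
UNCHANGED): the quantifier `∀ (F : HeegnerFamily …)` does not restrict the Manin constant `F.Dt.c` of
the family's parametrisation, whereas print's `κ` is built with ONE parametrisation of `p`-adic-unit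
Manin constant (BCK21 Remark 1.2; CGLS22 Conj. 1's factor `c_E⁻² u_K⁻²`; module docstring); for route
use this fact is SUPERSEDED by `thm59_XGr_isTorsion_bdp_iff_heegnerPoint_localised_pinned` (the same
with `¬ (p : ℤ) ∣ F.Dt.c`), which it implies (`thm59_pinned_of_thm59`).
[cite: YanZhu2024MainConjNonCM, Thm. 5.9 (§5.2, arXiv:2412.20078v4 TeX l.1283–1293) with setting l.1189–1190, `S_ord`/`κ` l.1199–1207, §3.5 l.882; = arXiv v2 Thm. 4.14]
[cite: Howard2004HeegnerKolyvagin, §1 and Thm. 3.3.7 (the currency `heegnerCharIdeal`, `𝐇 = Λκ`)] -/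
def thm59_XGr_isTorsion_bdp_iff_heegnerPoint_localised : Prop :=
  ∀ {p : ℕ} [Fact p.Prime] (ι' : PadicAlgCl p ≃+* ℂ) (W : WeierstrassCurve ℚ) [W.IsGloballyMinimal]
    (K : Type) [Field K] [NumberField K] (v vbar : HeightOneSpectrum (𝓞 K))
    (κ : ZpExtension K p) (γ : absoluteGaloisGroup K) [Fact (κ.IsTopGenerator γ)] {N : ℕ} [NeZero N]
    {f : CuspForm (CongruenceSubgroup.Gamma0 N) 2} (jbar : AlgebraicClosure K →+* ℂ)
    (_ : Thm57Hypotheses N W K p κ γ) (_ : IsNewformOf W f),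
    (∀ (w : InfinitePlace K) (k : 𝓞 K), k ∈ v.asIdeal ↔ ‖ι'.symm (w.embedding (k : K))‖ < 1) →
      ((p : ℕ) : 𝓞 K) ∈ vbar.asIdeal → vbar ≠ v →
    ∃ (ΩK : ℂ) (Ωp : (unrIntegers p)ˣ) (L : UnrSeries p),
      ΩK ≠ 0 ∧ IsBDPLFunction ι' v κ γ f ΩK ((Ωp : unrIntegers p) : ℂ_[p]) L ∧
      Module.IsTorsion (IwasawaAlgebra p) (AcSelmer.XAc (W.baseChange K) p κ vbar ∅ γ) ∧
      ∀ (D : (W.baseChange K).LambdaAdicSelmerData κ γ) (F : HeegnerFamily N W K κ jbar)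
        (X : (W.baseChange K).SelmerDualData κ γ) (j : ℤ_[p] →+* unrIntegers p),
        (∀ x : ℤ_[p], ((j x : unrIntegers p) : ℂ_[p]) = algebraMap ℚ_[p] ℂ_[p] (x : ℚ_[p])) →
        ∀ s : IwasawaAlgebra p, s ≠ 0 →
          ((∃ n : ℕ, (PowerSeries.map j s) ^ n * L ∈
              (AcSelmer.XAc.charIdeal (W.baseChange K) p κ vbar ∅ γ).map (PowerSeries.map j)) ↔
            (∃ n : ℕ, ∀ g ∈ heegnerCharIdeal D F ^ 2,
              s ^ n * g ∈ Module.charIdeal (IwasawaAlgebra p)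
                (Submodule.torsion (IwasawaAlgebra p) X.X))) ∧
          ((∃ n : ℕ, ∀ G ∈ (AcSelmer.XAc.charIdeal (W.baseChange K) p κ vbar ∅ γ).map
              (PowerSeries.map j), (PowerSeries.map j s) ^ n * G ∈ Ideal.span {L}) ↔
            (∃ n : ℕ, ∀ g ∈ Module.charIdeal (IwasawaAlgebra p)
              (Submodule.torsion (IwasawaAlgebra p) X.X), s ^ n * g ∈ heegnerCharIdeal D F ^ 2))

/-! ### Proved unfoldings -/

section API

variable {p : ℕ} [Fact p.Prime] {K : Type} [Field K] [NumberField K]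

/-- Theorem 5.9 contains the torsion of `𝒳_{𝓕_Gr}(E/K_∞⁻)` (also part of Thm. 5.7 (1)).
[cite: YanZhu2024MainConjNonCM, Thm. 5.9, first clause (arXiv:2412.20078v4 TeX l.1284)] -/
theorem isTorsion_XAc_of_thm59 (h : thm59_XGr_isTorsion_bdp_iff_heegnerPoint_localised)
    (ι' : PadicAlgCl p ≃+* ℂ) (W : WeierstrassCurve ℚ) [W.IsGloballyMinimal]
    (v vbar : HeightOneSpectrum (𝓞 K)) (κ : ZpExtension K p) (γ : absoluteGaloisGroup K)
    [Fact (κ.IsTopGenerator γ)] {N : ℕ} [NeZero N] {f : CuspForm (CongruenceSubgroup.Gamma0 N) 2}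
    (jbar : AlgebraicClosure K →+* ℂ) (hyp : Thm57Hypotheses N W K p κ γ) (hf : IsNewformOf W f)
    (hι : ∀ (w : InfinitePlace K) (k : 𝓞 K), k ∈ v.asIdeal ↔ ‖ι'.symm (w.embedding (k : K))‖ < 1)
    (hvbar : ((p : ℕ) : 𝓞 K) ∈ vbar.asIdeal) (hne : vbar ≠ v) :
    Module.IsTorsion (IwasawaAlgebra p) (AcSelmer.XAc (W.baseChange K) p κ vbar ∅ γ) := by
  obtain ⟨-, -, -, -, -, htor, -⟩ := h ι' W K v vbar κ γ jbar hyp hf hι hvbar hne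
  exact htor

/-- Theorem 5.9 turns the (unlocalised, `s = 1`) Heegner point divisibility
`(heegnerCharIdeal)² ⊆ char(𝒳_tor)` — e.g. Thm. 5.8's integral clause under full image — into the
BDP divisibility `L ∈ char(𝒳_Gr)·R₀⟦T⟧` up to a power of… nothing: with `s = 1` the localisation is
trivial, so `L ∈ char(𝒳_Gr)R₀⟦T⟧`. This is the step "The reverse divisibility is established by combining
Theorem 5.8 and Theorem 5.9" of the proof of Thm. 5.7 (l.1300), in its integral form.
[cite: YanZhu2024MainConjNonCM, proof of Thm. 5.7 (arXiv:2412.20078v4 TeX l.1295–1308)] -/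
theorem bdp_mem_of_heegner_le_of_thm59 (h : thm59_XGr_isTorsion_bdp_iff_heegnerPoint_localised)
    (ι' : PadicAlgCl p ≃+* ℂ) (W : WeierstrassCurve ℚ) [W.IsGloballyMinimal]
    (v vbar : HeightOneSpectrum (𝓞 K)) (κ : ZpExtension K p) (γ : absoluteGaloisGroup K)
    [Fact (κ.IsTopGenerator γ)] {N : ℕ} [NeZero N] {f : CuspForm (CongruenceSubgroup.Gamma0 N) 2}
    (jbar : AlgebraicClosure K →+* ℂ) (hyp : Thm57Hypotheses N W K p κ γ) (hf : IsNewformOf W f)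
    (hι : ∀ (w : InfinitePlace K) (k : 𝓞 K), k ∈ v.asIdeal ↔ ‖ι'.symm (w.embedding (k : K))‖ < 1)
    (hvbar : ((p : ℕ) : 𝓞 K) ∈ vbar.asIdeal) (hne : vbar ≠ v) :
    ∃ (ΩK : ℂ) (Ωp : (unrIntegers p)ˣ) (L : UnrSeries p),
      ΩK ≠ 0 ∧ IsBDPLFunction ι' v κ γ f ΩK ((Ωp : unrIntegers p) : ℂ_[p]) L ∧
      ∀ (D : (W.baseChange K).LambdaAdicSelmerData κ γ) (F : HeegnerFamily N W K κ jbar)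
        (X : (W.baseChange K).SelmerDualData κ γ) (j : ℤ_[p] →+* unrIntegers p),
        (∀ x : ℤ_[p], ((j x : unrIntegers p) : ℂ_[p]) = algebraMap ℚ_[p] ℂ_[p] (x : ℚ_[p])) →
        heegnerCharIdeal D F ^ 2 ≤
            Module.charIdeal (IwasawaAlgebra p) (Submodule.torsion (IwasawaAlgebra p) X.X) →
          L ∈ (AcSelmer.XAc.charIdeal (W.baseChange K) p κ vbar ∅ γ).map (PowerSeries.map j) := by
  obtain ⟨ΩK, Ωp, L, hΩK, hL, -, hiff⟩ := h ι' W K v vbar κ γ jbar hyp hf hι hvbar hne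
  refine ⟨ΩK, Ωp, L, hΩK, hL, fun D F X j hj hle ↦ ?_⟩
  have h1 : ∃ n : ℕ, ∀ g ∈ heegnerCharIdeal D F ^ 2,
      (1 : IwasawaAlgebra p) ^ n * g ∈
        Module.charIdeal (IwasawaAlgebra p) (Submodule.torsion (IwasawaAlgebra p) X.X) :=
    ⟨0, fun g hg ↦ by rw [pow_zero, one_mul]; exact hle hg⟩
  obtain ⟨n, hn⟩ := ((hiff D F X j hj 1 one_ne_zero).1).2 h1
  rwa [map_one, one_pow, one_mul] at hn

end API

/-! ## The PINNED typing (print's normalisation: `p ∤ c_π`) and its unfoldings -/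

/-- **Yan–Zhu, J. Algebra 693 (2026), Theorem 5.9 (arXiv v4 l.1283–1293; = v2 Thm. 4.14), PINNED to
print's normalisation of `κ`** — the same statement as
`thm59_XGr_isTorsion_bdp_iff_heegnerPoint_localised` with the equivalence asserted only for Heegner
families whose parametrisation has `p`-ADIC-UNIT MANIN CONSTANT, `¬ (p : ℤ) ∣ F.Dt.c`. Verbatim
(§5.2, "Fix a modular parametrization `π : X₀(N) → E` … `κ ∈ S_ord(E/K_∞⁻)` via the Kummer images of
Heegner points on `X₀(N)`"; "Similarly to [BCK], we have the following theorem"): "The module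
`𝒳_{𝓕_Gr}(E/K_∞⁻)` is `Λ_K⁻`-torsion, and for every nontrivial multiplicative set `S ⊂ Λ_K⁻`, the
following statements are equivalent: (1) `S⁻¹Char_{Λ_K⁻}(𝒳_{𝓕_Gr}(E/K_∞⁻))Λ_K^{ur,−} ⊃ (𝓛_p^BDP(E/K))`.
(2) `S⁻¹Char_{Λ_K⁻}(𝒳_{𝓕_ord}(E/K_∞⁻)_tor) ⊃ S⁻¹Char_{Λ_K⁻}(S_ord(E/K_∞⁻)/Λ_K⁻·κ)²`. The equivalence
also holds with the divisibility reversed", under §5.2's setting (`p > 2` good ordinary, `K` imaginary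
quadratic, `p = 𝔭𝔭̄` split, `(E, K)` Heegner, `ρ̄_E|_{G_K}` irreducible) and §3.5 (`D_K` odd, `≠ −3`).
THE PIN (printed hypotheses of the source of the proof, carried verbatim — Burungale–Castella–Kim,
ANT 15 (2021), whose Thm. 5.2 the printed proof invokes): Remark 1.2, "As formulated in [PR87, Conj. B],
the second equality of characteristic ideals in (ii) includes the factor `c_π · (#𝒪_K^×)/2`, where
`c_π ∈ ℤ_{>0}` is the Manin constant associated to `π`. However, `𝒪_K^× = {±1}` by our hypothesis
(disc), and `c_π` is a `p`-adic unit by [Mazur] and our hypothesis that `p ∤ N`"; App. A: "`E` …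
`(ℤ, pℤ_p)`-optimal … `π : J(X_{N⁺,N⁻}) → E` the quotient map"; the equivalence of Thm. 5.2 rests on
the EXACT identity (A4) `ord_{𝔓'}(𝓛_𝔭^BDP) = length(coker(loc_𝔭)Λ^ur) + length(𝒮^ur/Λ^ur κ_∞)` for
that class (explicit reciprocity law Thm. 4.4: `Log_𝔭(loc_𝔭 κ_∞) = −𝓛_𝔭^BDP σ_{−1,𝔭}`); CGLS22 Conj. 1
displays the same factor as `(c_E² u_K²)⁻¹`, `π^*(ω_E) = c_E · 2πi f dτ`. In the tree `F.Dt.c` IS that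
constant (`φ = uniformize (c · 2πi ∫ f)`, `ModularCurve.lean`) and `u_K = 1` under `Thm57Hypotheses`
(`D_K` odd, `≠ −3`), so "`c_π u_K` is a `p`-adic unit" reads `¬ (p : ℤ) ∣ F.Dt.c`.
Transcription: exactly that of the unpinned fact (module docstring) — hypotheses `Thm57Hypotheses N W K
p κ γ` (+ EXTRA `p ∤ h_K` of the Heegner-family vocabulary, special case), `ι'`/`v`/`vbar`,
`IsNewformOf W f`; conclusion: a frame `(Ω_K, Ω_p, L)` of `𝓛_p^BDP(E/K)` with `𝒳 = AcSelmer.XAc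
(W.baseChange K) p κ vbar ∅ γ` torsion and, for all data `D`, `F`, `X`, `j` WITH `¬ (p : ℤ) ∣ F.Dt.c`,
for every `s ∈ Λ ∖ {0}`: [`∃ n, j(s)ⁿ·L ∈ char(𝒳)·R₀⟦T⟧`] ↔ [`∃ n, sⁿ·(heegnerCharIdeal D F)² ⊆
char(X.X_tors)`], and the reversed pair. WEAKER than the unpinned typing (`thm59_pinned_of_thm59`);
refereed, proof by reference to [BCK, Thm. 5.2]; nothing asserted.
[cite: YanZhu2024MainConjNonCM, Thm. 5.9 (§5.2, arXiv:2412.20078v4 TeX l.1283–1293) with setting l.1189–1190, `κ` l.1205–1207, §3.5 l.882; = arXiv v2 Thm. 4.14 (p0011 L59, L96–L105)]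
[cite: BurungaleCastellaKim2021, Remark 1.2 (arXiv:1908.09512v2 TeX l.192–195), Thm. 5.2 with its proof eq. (A4) (l.1079–1081), Thm. 4.4 eq. (ERL) (l.929–941), App. A (l.1116–1120)]
[cite: CastellaGrossiLeeSkinner2022, §1 Conj. 1 (arXiv:2008.02571 p. 3: the factor `(c_E² u_K²)⁻¹`, `π^*(ω_E) = c_E · 2πi f dτ`)]
[cite: Howard2004HeegnerKolyvagin, §1 and Thm. 3.3.7 (the currency `heegnerCharIdeal`, `𝐇 = Λκ`)] -/
def thm59_XGr_isTorsion_bdp_iff_heegnerPoint_localised_pinned : Prop :=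
  ∀ {p : ℕ} [Fact p.Prime] (ι' : PadicAlgCl p ≃+* ℂ) (W : WeierstrassCurve ℚ) [W.IsGloballyMinimal]
    (K : Type) [Field K] [NumberField K] (v vbar : HeightOneSpectrum (𝓞 K))
    (κ : ZpExtension K p) (γ : absoluteGaloisGroup K) [Fact (κ.IsTopGenerator γ)] {N : ℕ} [NeZero N]
    {f : CuspForm (CongruenceSubgroup.Gamma0 N) 2} (jbar : AlgebraicClosure K →+* ℂ)
    (_ : Thm57Hypotheses N W K p κ γ) (_ : IsNewformOf W f),
    (∀ (w : InfinitePlace K) (k : 𝓞 K), k ∈ v.asIdeal ↔ ‖ι'.symm (w.embedding (k : K))‖ < 1) →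
      ((p : ℕ) : 𝓞 K) ∈ vbar.asIdeal → vbar ≠ v →
    ∃ (ΩK : ℂ) (Ωp : (unrIntegers p)ˣ) (L : UnrSeries p),
      ΩK ≠ 0 ∧ IsBDPLFunction ι' v κ γ f ΩK ((Ωp : unrIntegers p) : ℂ_[p]) L ∧
      Module.IsTorsion (IwasawaAlgebra p) (AcSelmer.XAc (W.baseChange K) p κ vbar ∅ γ) ∧
      ∀ (D : (W.baseChange K).LambdaAdicSelmerData κ γ) (F : HeegnerFamily N W K κ jbar)
        (X : (W.baseChange K).SelmerDualData κ γ) (j : ℤ_[p] →+* unrIntegers p),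
        ¬ (p : ℤ) ∣ F.Dt.c →
        (∀ x : ℤ_[p], ((j x : unrIntegers p) : ℂ_[p]) = algebraMap ℚ_[p] ℂ_[p] (x : ℚ_[p])) →
        ∀ s : IwasawaAlgebra p, s ≠ 0 →
          ((∃ n : ℕ, (PowerSeries.map j s) ^ n * L ∈
              (AcSelmer.XAc.charIdeal (W.baseChange K) p κ vbar ∅ γ).map (PowerSeries.map j)) ↔
            (∃ n : ℕ, ∀ g ∈ heegnerCharIdeal D F ^ 2,
              s ^ n * g ∈ Module.charIdeal (IwasawaAlgebra p)
                (Submodule.torsion (IwasawaAlgebra p) X.X))) ∧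
          ((∃ n : ℕ, ∀ G ∈ (AcSelmer.XAc.charIdeal (W.baseChange K) p κ vbar ∅ γ).map
              (PowerSeries.map j), (PowerSeries.map j s) ^ n * G ∈ Ideal.span {L}) ↔
            (∃ n : ℕ, ∀ g ∈ Module.charIdeal (IwasawaAlgebra p)
              (Submodule.torsion (IwasawaAlgebra p) X.X), s ^ n * g ∈ heegnerCharIdeal D F ^ 2))

section PinnedAPI

variable {p : ℕ} [Fact p.Prime] {K : Type} [Field K] [NumberField K]

/-- **The pinned typing is implied by the unpinned one** (it asserts the equivalence for FEWER
families): `thm59_… → thm59_…_pinned`. Bookkeeping, recorded so that the pinned fact is visibly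
WEAKER than the accepted typing — never stronger than the source.
[cite: YanZhu2024MainConjNonCM, Thm. 5.9 (arXiv:2412.20078v4 TeX l.1283–1293)] -/
theorem thm59_pinned_of_thm59 (h : thm59_XGr_isTorsion_bdp_iff_heegnerPoint_localised) :
    thm59_XGr_isTorsion_bdp_iff_heegnerPoint_localised_pinned := by
  intro p _ ι' W _ K _ _ v vbar κ γ _ N _ f jbar hyp hf hι hvbar hne
  obtain ⟨ΩK, Ωp, L, hΩK, hL, htor, hiff⟩ := h ι' W K v vbar κ γ jbar hyp hf hι hvbar hne
  exact ⟨ΩK, Ωp, L, hΩK, hL, htor, fun D F X j _ hj s hs ↦ hiff D F X j hj s hs⟩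

/-- Theorem 5.9 (pinned) contains the torsion of `𝒳_{𝓕_Gr}(E/K_∞⁻)` (also part of Thm. 5.7 (1)); the
pin does not touch this clause. [cite: YanZhu2024MainConjNonCM, Thm. 5.9, first clause (arXiv:2412.20078v4 TeX l.1284)] -/
theorem isTorsion_XAc_of_thm59_pinned (h : thm59_XGr_isTorsion_bdp_iff_heegnerPoint_localised_pinned)
    (ι' : PadicAlgCl p ≃+* ℂ) (W : WeierstrassCurve ℚ) [W.IsGloballyMinimal]
    (v vbar : HeightOneSpectrum (𝓞 K)) (κ : ZpExtension K p) (γ : absoluteGaloisGroup K)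
    [Fact (κ.IsTopGenerator γ)] {N : ℕ} [NeZero N] {f : CuspForm (CongruenceSubgroup.Gamma0 N) 2}
    (jbar : AlgebraicClosure K →+* ℂ) (hyp : Thm57Hypotheses N W K p κ γ) (hf : IsNewformOf W f)
    (hι : ∀ (w : InfinitePlace K) (k : 𝓞 K), k ∈ v.asIdeal ↔ ‖ι'.symm (w.embedding (k : K))‖ < 1)
    (hvbar : ((p : ℕ) : 𝓞 K) ∈ vbar.asIdeal) (hne : vbar ≠ v) :
    Module.IsTorsion (IwasawaAlgebra p) (AcSelmer.XAc (W.baseChange K) p κ vbar ∅ γ) := by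
  obtain ⟨-, -, -, -, -, htor, -⟩ := h ι' W K v vbar κ γ jbar hyp hf hι hvbar hne
  exact htor

/-- **Theorem 5.9 (pinned) at `S = {1}`**: for a Heegner family WITH `p`-adic-unit Manin constant
(`¬ (p : ℤ) ∣ F.Dt.c`), the integral Heegner point divisibility `(heegnerCharIdeal D F)² ⊆ char(𝒳_tor)`
gives the integral BDP divisibility `L ∈ char(𝒳_Gr)·R₀⟦T⟧` — the step "The reverse divisibility is
established by combining Theorem 5.8 and Theorem 5.9" of the proof of Thm. 5.7 (l.1300), integrally,
for print's class. Same unfolding as `bdp_mem_of_heegner_le_of_thm59`, with the pin threaded (callers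
pass `hc` before `hle`). [cite: YanZhu2024MainConjNonCM, proof of Thm. 5.7 (arXiv:2412.20078v4 TeX l.1295–1308)]
[cite: BurungaleCastellaKim2021, Remark 1.2 and Thm. 5.2 (arXiv:1908.09512v2 TeX l.192–195, l.1044–1097)] -/
theorem bdp_mem_of_heegner_le_of_thm59_pinned
    (h : thm59_XGr_isTorsion_bdp_iff_heegnerPoint_localised_pinned)
    (ι' : PadicAlgCl p ≃+* ℂ) (W : WeierstrassCurve ℚ) [W.IsGloballyMinimal]
    (v vbar : HeightOneSpectrum (𝓞 K)) (κ : ZpExtension K p) (γ : absoluteGaloisGroup K)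
    [Fact (κ.IsTopGenerator γ)] {N : ℕ} [NeZero N] {f : CuspForm (CongruenceSubgroup.Gamma0 N) 2}
    (jbar : AlgebraicClosure K →+* ℂ) (hyp : Thm57Hypotheses N W K p κ γ) (hf : IsNewformOf W f)
    (hι : ∀ (w : InfinitePlace K) (k : 𝓞 K), k ∈ v.asIdeal ↔ ‖ι'.symm (w.embedding (k : K))‖ < 1)
    (hvbar : ((p : ℕ) : 𝓞 K) ∈ vbar.asIdeal) (hne : vbar ≠ v) :
    ∃ (ΩK : ℂ) (Ωp : (unrIntegers p)ˣ) (L : UnrSeries p),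
      ΩK ≠ 0 ∧ IsBDPLFunction ι' v κ γ f ΩK ((Ωp : unrIntegers p) : ℂ_[p]) L ∧
      ∀ (D : (W.baseChange K).LambdaAdicSelmerData κ γ) (F : HeegnerFamily N W K κ jbar)
        (X : (W.baseChange K).SelmerDualData κ γ) (j : ℤ_[p] →+* unrIntegers p),
        (∀ x : ℤ_[p], ((j x : unrIntegers p) : ℂ_[p]) = algebraMap ℚ_[p] ℂ_[p] (x : ℚ_[p])) →
        ¬ (p : ℤ) ∣ F.Dt.c →
        heegnerCharIdeal D F ^ 2 ≤
            Module.charIdeal (IwasawaAlgebra p) (Submodule.torsion (IwasawaAlgebra p) X.X) →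
          L ∈ (AcSelmer.XAc.charIdeal (W.baseChange K) p κ vbar ∅ γ).map (PowerSeries.map j) := by
  obtain ⟨ΩK, Ωp, L, hΩK, hL, -, hiff⟩ := h ι' W K v vbar κ γ jbar hyp hf hι hvbar hne
  refine ⟨ΩK, Ωp, L, hΩK, hL, fun D F X j hj hc hle ↦ ?_⟩
  have h1 : ∃ n : ℕ, ∀ g ∈ heegnerCharIdeal D F ^ 2,
      (1 : IwasawaAlgebra p) ^ n * g ∈
        Module.charIdeal (IwasawaAlgebra p) (Submodule.torsion (IwasawaAlgebra p) X.X) :=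
    ⟨0, fun g hg ↦ by rw [pow_zero, one_mul]; exact hle hg⟩
  obtain ⟨n, hn⟩ := ((hiff D F X j hc hj 1 one_ne_zero).1).2 h1
  rwa [map_one, one_pow, one_mul] at hn

end PinnedAPI

/-! ## The class-number-free PINNED typing: the two print-implied halves (REF-106 (b)) -/

/-- **Yan–Zhu, J. Algebra 693 (2026), Theorem 5.9 (arXiv v4 l.1283–1293; = v2 Thm. 4.14) = Castella–
Grossi–Lee–Skinner, Invent. Math. 227 (2022), Prop. 4.2.1 at every multiplicative `S` — PINNED to
print's normalisation of `κ` and AT EVERY CLASS NUMBER, the two halves "(2) ⟹ (1)" and "(1′) ⟹ (2′)".**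
Yan–Zhu, verbatim (§5.2, NO class-number hypothesis: "Let `E/ℚ` be an elliptic curve of conductor `N`,
`p > 2` a prime such that `E` has good ordinary reduction at `p`, `K` an imaginary quadratic field such
that `p = 𝔭𝔭̄` split in `K` and `(E, K)` satisfies the Heegner hypothesis. Assume that residue
representation `ρ̄_E|_{G_K}` is irreducible"; "Fix a modular parametrization `π : X₀(N) → E` … `κ`";
"Similarly to [BCK]"): "`𝒳_{𝓕_Gr}(E/K_∞⁻)` is `Λ_K`-torsion and for every nontrivial multiplicative set
`S ⊂ Λ_K⁻`, the following are equivalent (1) `S⁻¹Char_{Λ_K}(𝒳_{𝓕_Gr}(E/K_∞⁻))Λ_K^{ur,−} ⊃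
(𝓛_p^BDP(E/K))`. (2) `S⁻¹Char_{Λ_K⁻}(𝒳_ord(E/K_∞⁻)_tor) ⊃ S⁻¹Char_{Λ_K⁻}(S_ord(E/K_∞⁻)/Λ_K⁻·κ)²`. The
same result holds for the opposite divisibilities." CGLS Prop. 4.2.1, verbatim (§4.1 standing: `p ∤ 2N`
good ordinary, (Heeg), (disc), `π : X₀(N) → E` fixed, `κ_∞` the `d(k)`-shifted `α`-stabilised class of
Rem. 4.1.4, ANY `h_K`): "Assume that `p = v v̄` splits in `K` and that `E(K)[p] = 0`, and let `Λ'` denote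
either `Λ` or `Λ[1/p]`. Then the following statements are equivalent: (i) Both `H¹_{𝓕_Λ}(K, 𝐓)` and
`H¹_{𝓕_Λ}(K, M_E)` have `Λ`-rank one, and the divisibility `char_Λ(H¹_{𝓕_Λ}(K, M_E)^∨_tors) ⊃
char_Λ(H¹_{𝓕_Λ}(K, 𝐓)/Λκ_∞)²` holds in `Λ'`. (ii) Both `𝔛_E` and `𝔖_E` are `Λ`-torsion, and the
divisibility `char_Λ(𝔛_E)Λ^ur ⊃ (𝓛_E)` holds in `Λ' ⊗̂ ℤ_p^ur`. Moreover, the same result holds for the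
opposite divisibilities. *Proof.* See [BCK], whose proof still applies after inverting `p`." THE PIN
(Burungale–Castella–Kim 2021 Remark 1.2: Perrin-Riou's factor `c_π · #𝒪_K^×/2`, "`c_π` is a `p`-adic
unit"; App. A `(ℤ, pℤ_p)`-optimal quotient map; Thm. 5.2 via the exact (A4)/ERL Thm. 4.4; CGLS Conj. 1
factor `(c_E² u_K²)⁻¹`): `¬ (p : ℤ) ∣ F.Dt.c`, `u_K = 1` from `D_K` odd `≠ −3`. PAGE CHECK of the class
(module docstring): [BCK21] Thm. 5.2's `κ_∞` is built over `K_n := H_{p^n} ∩ K_∞` (TeX l.662), no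
class-number hypothesis in the paper; CGLS Prop. 4.2.1 is the printed any-`h_K` statement. HALVES
RECORDED (REF-106 (b)): with the tree's side (2) = `(heegnerCharIdeal D F)²` = `char(𝔖/ℋ_F)²` for
Howard's module `ℋ_F ⊇ Λκ`, print implies "(2) ⟹ (1)" and "(1′) ⟹ (2′)" (`char(𝔖/Λκ) ⊆ I(ℋ_F)`); the
two other halves are NOT recorded here (they are in the `p ∤ h_K` fact
`thm59_XGr_isTorsion_bdp_iff_heegnerPoint_localised_pinned`). Transcription — binders, in this order:
`ι'`, `W` (elliptic, globally minimal), `K`, `v`, `vbar`, `κ`, `γ` (`[Fact (κ.IsTopGenerator γ)]`), `f`,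
`jbar`, `IsNewformOf W f`, `N = N_E`, `3 ≤ p`, `GoodOrd W p`, (irr_K), `IsImaginaryQuadratic K`,
(Heeg) for `N`, (spl) as `#((p).primesOver 𝓞_K) = 2`, `D_K` odd, `D_K ≠ −3`, `κ` anticyclotomic, the
`ι'`/`v` compatibility clause, `p ∈ vbar`, `vbar ≠ v`; conclusion: a frame `(Ω_K, Ω_p, L)` of
`𝓛_p^BDP(E/K)` with `𝒳 = AcSelmer.XAc (W.baseChange K) p κ vbar ∅ γ` torsion and, for all data
`D F X j` WITH `¬ (p : ℤ) ∣ F.Dt.c`, every `s ≠ 0`: [(2)_s → (1)_s] ∧ [(1′)_s → (2′)_s] in the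
one-element localisation form of the module docstring. Refereed (J. Algebra 693; Invent. Math. 227);
WEAKER than a double equivalence; nothing asserted.
[cite: YanZhu2024MainConjNonCM, Thm. 5.9 (§5.2, arXiv:2412.20078v4 TeX l.1283–1293) with setting l.1189–1190 (v2 p0011 L49–L52, L59, L96–L105)]
[cite: CastellaGrossiLeeSkinner2022, Prop. 4.2.1 (arXiv:2008.02571 p0022 L104 – p0023 L9) with §4.1 standing (p0022 L5–L17), Thm. 4.1.1 and Rem. 4.1.4 (κ_∞, any class number)]
[cite: BurungaleCastellaKim2021, Thm. 5.2 (arXiv:1908.09512v2 TeX l.1044–1097; κ_∞ of eq. (dist) l.700–704 built in §3 l.655–672 over `K_n := H_{p^n} ∩ K_∞`); Remark 1.2 (l.192–195, the pin)]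
[cite: Howard2004HeegnerKolyvagin, §1 and Thm. 3.3.7 (the currency `heegnerCharIdeal`, `𝐇 ⊇ Λκ`)] -/
def thm59_localised_pinned_anyClassNumber : Prop :=
  ∀ {p : ℕ} [Fact p.Prime] (ι' : PadicAlgCl p ≃+* ℂ) (W : WeierstrassCurve ℚ) [W.IsElliptic]
    [W.IsGloballyMinimal] (K : Type) [Field K] [NumberField K] (v vbar : HeightOneSpectrum (𝓞 K))
    (κ : ZpExtension K p) (γ : absoluteGaloisGroup K) [Fact (κ.IsTopGenerator γ)] {N : ℕ} [NeZero N]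
    {f : CuspForm (CongruenceSubgroup.Gamma0 N) 2} (jbar : AlgebraicClosure K →+* ℂ)
    (_ : IsNewformOf W f),
    N = W.conductorNorm ℤ → 3 ≤ p → GoodOrd W p → (W.baseChange K).HasIrreducibleModPGaloisRep p →
    IsImaginaryQuadratic K → SatisfiesHeegnerHypothesis N K →
      ((Ideal.span {(p : ℤ)}).primesOver (𝓞 K)).ncard = 2 →
      Odd (NumberField.discr K) → NumberField.discr K ≠ -3 → κ.IsAnticyclotomic →
    (∀ (w : InfinitePlace K) (k : 𝓞 K), k ∈ v.asIdeal ↔ ‖ι'.symm (w.embedding (k : K))‖ < 1) →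
      ((p : ℕ) : 𝓞 K) ∈ vbar.asIdeal → vbar ≠ v →
    ∃ (ΩK : ℂ) (Ωp : (unrIntegers p)ˣ) (L : UnrSeries p),
      ΩK ≠ 0 ∧ IsBDPLFunction ι' v κ γ f ΩK ((Ωp : unrIntegers p) : ℂ_[p]) L ∧
      Module.IsTorsion (IwasawaAlgebra p) (AcSelmer.XAc (W.baseChange K) p κ vbar ∅ γ) ∧
      ∀ (D : (W.baseChange K).LambdaAdicSelmerData κ γ) (F : HeegnerFamily N W K κ jbar)
        (X : (W.baseChange K).SelmerDualData κ γ) (j : ℤ_[p] →+* unrIntegers p),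
        ¬ (p : ℤ) ∣ F.Dt.c →
        (∀ x : ℤ_[p], ((j x : unrIntegers p) : ℂ_[p]) = algebraMap ℚ_[p] ℂ_[p] (x : ℚ_[p])) →
        ∀ s : IwasawaAlgebra p, s ≠ 0 →
          ((∃ n : ℕ, ∀ g ∈ heegnerCharIdeal D F ^ 2,
              s ^ n * g ∈ Module.charIdeal (IwasawaAlgebra p)
                (Submodule.torsion (IwasawaAlgebra p) X.X)) →
            (∃ n : ℕ, (PowerSeries.map j s) ^ n * L ∈
              (AcSelmer.XAc.charIdeal (W.baseChange K) p κ vbar ∅ γ).map (PowerSeries.map j))) ∧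
          ((∃ n : ℕ, ∀ G ∈ (AcSelmer.XAc.charIdeal (W.baseChange K) p κ vbar ∅ γ).map
              (PowerSeries.map j), (PowerSeries.map j s) ^ n * G ∈ Ideal.span {L}) →
            (∃ n : ℕ, ∀ g ∈ Module.charIdeal (IwasawaAlgebra p)
              (Submodule.torsion (IwasawaAlgebra p) X.X), s ^ n * g ∈ heegnerCharIdeal D F ^ 2))

section AnyClassNumberAPI

variable {p : ℕ} [Fact p.Prime] {K : Type} [Field K] [NumberField K]

/-- The class-number-free pinned fact contains the torsion of `𝒳_{𝓕_Gr}(E/K_∞⁻)` (Thm. 5.9, first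
clause; also Thm. 5.7 (1)). [cite: YanZhu2024MainConjNonCM, Thm. 5.9, first clause (arXiv:2412.20078v4 TeX l.1284)] -/
theorem isTorsion_XAc_of_thm59_anyClassNumber (h : thm59_localised_pinned_anyClassNumber)
    (ι' : PadicAlgCl p ≃+* ℂ) (W : WeierstrassCurve ℚ) [W.IsElliptic] [W.IsGloballyMinimal]
    (v vbar : HeightOneSpectrum (𝓞 K)) (κ : ZpExtension K p) (γ : absoluteGaloisGroup K)
    [Fact (κ.IsTopGenerator γ)] {N : ℕ} [NeZero N] {f : CuspForm (CongruenceSubgroup.Gamma0 N) 2}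
    (jbar : AlgebraicClosure K →+* ℂ) (hf : IsNewformOf W f) (hN : N = W.conductorNorm ℤ)
    (hp : 3 ≤ p) (hord : GoodOrd W p) (hirr : (W.baseChange K).HasIrreducibleModPGaloisRep p)
    (hK : IsImaginaryQuadratic K) (hH : SatisfiesHeegnerHypothesis N K)
    (hsplit : ((Ideal.span {(p : ℤ)}).primesOver (𝓞 K)).ncard = 2)
    (hodd : Odd (NumberField.discr K)) (h3 : NumberField.discr K ≠ -3) (hκ : κ.IsAnticyclotomic)
    (hι : ∀ (w : InfinitePlace K) (k : 𝓞 K), k ∈ v.asIdeal ↔ ‖ι'.symm (w.embedding (k : K))‖ < 1)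
    (hvbar : ((p : ℕ) : 𝓞 K) ∈ vbar.asIdeal) (hne : vbar ≠ v) :
    Module.IsTorsion (IwasawaAlgebra p) (AcSelmer.XAc (W.baseChange K) p κ vbar ∅ γ) := by
  obtain ⟨-, -, -, -, -, htor, -⟩ :=
    h ι' W K v vbar κ γ jbar hf hN hp hord hirr hK hH hsplit hodd h3 hκ hι hvbar hne
  exact htor

/-- **The half (2) ⟹ (1) at `S = {1}`, pinned, at every class number** — LETTER FOR LETTER the
hypothesis `h59gp` of the cell's kernel theorem `composite_of_printFacts_of_pinnedTransfer`
(`Summits/…/PrintX10bTwoSidedLinkAnyClassNumberX10bOfPrintFactsPinned.lean`, p607932): for a Heegner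
family with `p`-adic-unit Manin constant, the integral containment `(heegnerCharIdeal D F)² ⊆
char(𝒳_tor)` gives `L ∈ char(𝒳_Gr)·R₀⟦T⟧`. So that hypothesis is discharged by
`bdp_mem_of_heegner_le_pinned_anyClassNumber h`.
[cite: YanZhu2024MainConjNonCM, Thm. 5.9 and proof of Thm. 5.7 (arXiv:2412.20078v4 TeX l.1283–1308)]
[cite: CastellaGrossiLeeSkinner2022, Prop. 4.2.1 ((i) ⟹ (ii) with `Λ' = Λ`)] -/
theorem bdp_mem_of_heegner_le_pinned_anyClassNumber (h : thm59_localised_pinned_anyClassNumber) :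
    ∀ {p : ℕ} [Fact p.Prime] (ι' : PadicAlgCl p ≃+* ℂ) (W : WeierstrassCurve ℚ) [W.IsElliptic]
      [W.IsGloballyMinimal] (K : Type) [Field K] [NumberField K] (v vbar : HeightOneSpectrum (𝓞 K))
      (κ : ZpExtension K p) (γ : absoluteGaloisGroup K) [Fact (κ.IsTopGenerator γ)] {N : ℕ} [NeZero N]
      {f : CuspForm (CongruenceSubgroup.Gamma0 N) 2} (jbar : AlgebraicClosure K →+* ℂ)
      (_ : IsNewformOf W f),
      N = W.conductorNorm ℤ → 3 ≤ p → GoodOrd W p → (W.baseChange K).HasIrreducibleModPGaloisRep p →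
      IsImaginaryQuadratic K → SatisfiesHeegnerHypothesis N K →
        ((Ideal.span {(p : ℤ)}).primesOver (𝓞 K)).ncard = 2 →
        Odd (NumberField.discr K) → NumberField.discr K ≠ -3 → κ.IsAnticyclotomic →
      (∀ (w : InfinitePlace K) (k : 𝓞 K), k ∈ v.asIdeal ↔ ‖ι'.symm (w.embedding (k : K))‖ < 1) →
        ((p : ℕ) : 𝓞 K) ∈ vbar.asIdeal → vbar ≠ v →
      ∃ (ΩK : ℂ) (Ωp : (unrIntegers p)ˣ) (L : UnrSeries p),
        ΩK ≠ 0 ∧ IsBDPLFunction ι' v κ γ f ΩK ((Ωp : unrIntegers p) : ℂ_[p]) L ∧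
        ∀ (D : (W.baseChange K).LambdaAdicSelmerData κ γ) (F : HeegnerFamily N W K κ jbar)
          (X : (W.baseChange K).SelmerDualData κ γ) (j : ℤ_[p] →+* unrIntegers p),
          ¬ (p : ℤ) ∣ F.Dt.c →
          (∀ x : ℤ_[p], ((j x : unrIntegers p) : ℂ_[p]) = algebraMap ℚ_[p] ℂ_[p] (x : ℚ_[p])) →
          heegnerCharIdeal D F ^ 2 ≤
              Module.charIdeal (IwasawaAlgebra p) (Submodule.torsion (IwasawaAlgebra p) X.X) →
            L ∈ (AcSelmer.XAc.charIdeal (W.baseChange K) p κ vbar ∅ γ).map (PowerSeries.map j) := by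
  intro p _ ι' W _ _ K _ _ v vbar κ γ _ N _ f jbar hf hN hp hord hirr hK hH hsplit hodd h3 hκ hι
    hvbar hne
  obtain ⟨ΩK, Ωp, L, hΩK, hL, -, himp⟩ :=
    h ι' W K v vbar κ γ jbar hf hN hp hord hirr hK hH hsplit hodd h3 hκ hι hvbar hne
  refine ⟨ΩK, Ωp, L, hΩK, hL, fun D F X j hc hj hle ↦ ?_⟩
  have h1 : ∃ n : ℕ, ∀ g ∈ heegnerCharIdeal D F ^ 2,
      (1 : IwasawaAlgebra p) ^ n * g ∈
        Module.charIdeal (IwasawaAlgebra p) (Submodule.torsion (IwasawaAlgebra p) X.X) :=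
    ⟨0, fun g hg ↦ by rw [pow_zero, one_mul]; exact hle hg⟩
  obtain ⟨n, hn⟩ := ((himp D F X j hc hj 1 one_ne_zero).1) h1
  rwa [map_one, one_pow, one_mul] at hn

/-- **Consistency with the `p ∤ h_K` double equivalence**: under `Thm57Hypotheses` (which add
`¬ p ∣ h_K` to the same setting), the pinned double equivalence
`thm59_XGr_isTorsion_bdp_iff_heegnerPoint_localised_pinned` yields the two halves recorded by the
class-number-free fact, at those data. Bookkeeping (`Iff.mp` twice).
[cite: YanZhu2024MainConjNonCM, Thm. 5.9 (arXiv:2412.20078v4 TeX l.1283–1293)] -/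
theorem halves_of_thm59_pinned (h : thm59_XGr_isTorsion_bdp_iff_heegnerPoint_localised_pinned)
    (ι' : PadicAlgCl p ≃+* ℂ) (W : WeierstrassCurve ℚ) [W.IsGloballyMinimal]
    (v vbar : HeightOneSpectrum (𝓞 K)) (κ : ZpExtension K p) (γ : absoluteGaloisGroup K)
    [Fact (κ.IsTopGenerator γ)] {N : ℕ} [NeZero N] {f : CuspForm (CongruenceSubgroup.Gamma0 N) 2}
    (jbar : AlgebraicClosure K →+* ℂ) (hyp : Thm57Hypotheses N W K p κ γ) (hf : IsNewformOf W f)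
    (hι : ∀ (w : InfinitePlace K) (k : 𝓞 K), k ∈ v.asIdeal ↔ ‖ι'.symm (w.embedding (k : K))‖ < 1)
    (hvbar : ((p : ℕ) : 𝓞 K) ∈ vbar.asIdeal) (hne : vbar ≠ v) :
    ∃ (ΩK : ℂ) (Ωp : (unrIntegers p)ˣ) (L : UnrSeries p),
      ΩK ≠ 0 ∧ IsBDPLFunction ι' v κ γ f ΩK ((Ωp : unrIntegers p) : ℂ_[p]) L ∧
      Module.IsTorsion (IwasawaAlgebra p) (AcSelmer.XAc (W.baseChange K) p κ vbar ∅ γ) ∧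
      ∀ (D : (W.baseChange K).LambdaAdicSelmerData κ γ) (F : HeegnerFamily N W K κ jbar)
        (X : (W.baseChange K).SelmerDualData κ γ) (j : ℤ_[p] →+* unrIntegers p),
        ¬ (p : ℤ) ∣ F.Dt.c →
        (∀ x : ℤ_[p], ((j x : unrIntegers p) : ℂ_[p]) = algebraMap ℚ_[p] ℂ_[p] (x : ℚ_[p])) →
        ∀ s : IwasawaAlgebra p, s ≠ 0 →
          ((∃ n : ℕ, ∀ g ∈ heegnerCharIdeal D F ^ 2,
              s ^ n * g ∈ Module.charIdeal (IwasawaAlgebra p)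
                (Submodule.torsion (IwasawaAlgebra p) X.X)) →
            (∃ n : ℕ, (PowerSeries.map j s) ^ n * L ∈
              (AcSelmer.XAc.charIdeal (W.baseChange K) p κ vbar ∅ γ).map (PowerSeries.map j))) ∧
          ((∃ n : ℕ, ∀ G ∈ (AcSelmer.XAc.charIdeal (W.baseChange K) p κ vbar ∅ γ).map
              (PowerSeries.map j), (PowerSeries.map j s) ^ n * G ∈ Ideal.span {L}) →
            (∃ n : ℕ, ∀ g ∈ Module.charIdeal (IwasawaAlgebra p)
              (Submodule.torsion (IwasawaAlgebra p) X.X), s ^ n * g ∈ heegnerCharIdeal D F ^ 2)) := by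
  obtain ⟨ΩK, Ωp, L, hΩK, hL, htor, hiff⟩ := h ι' W K v vbar κ γ jbar hyp hf hι hvbar hne
  exact ⟨ΩK, Ωp, L, hΩK, hL, htor, fun D F X j hc hj s hs ↦
    ⟨((hiff D F X j hc hj s hs).1).2, ((hiff D F X j hc hj s hs).2).1⟩⟩

end AnyClassNumberAPI

end Literature.NumberTheory.EllipticCurves.YanZhu2026

end
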